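import Summits.CriticalPhenomena.PercolationContinuityZ3.Theorems.Transplant.SkelPhiFaceHoldsKits9
import Summits.CriticalPhenomena.PercolationContinuityZ3.Theorems.Transplant.SkelNegBChoiceAllTA
import Summits.CriticalPhenomena.PercolationContinuityZ3.Theorems.Transplant.SkelPhiCylRadOri
import HarnessLib

/-!
# N1 ({±1} node), (F) column — THE WRAPPER'S LAYER (a0), chain v7 (hp-8 g36): `NegB.faceOblRM_negBTC₀` = `Skelφ.faceOblRM_of_kits9`
# (fineNb2 ∘ keystone v7) INSTANTIATED AT THE (ζ′) TUPLE — `pr := prFA`, `φ := φL`, `P := fcellsA`, `w₀ := t`,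
# `(gap, gap', E₀, L') := (Prm.gap S, 0, Prm.E₀ S, Prm.Lp S)` with `S := Sv κ Φ t p O.merged g f q`, `off := offNA`, `b₀ := b0TA`, `δc := κ.δ`,
# `Δ' := Φ.Δ`, `δ₂ := κ.δ₂`, `hlip/hstep/hfr/hκ/hΔg` discharged; conclusion BY NAME `FaceOblRM G ((choiceAtOTA …).scheme O q) ((choiceAtOTA …).FD O q) Φ.Δ κ.δ₂`
# (the identification is `rfl`, stmt-g16's `SkelNegBChoiceAllTA`).  v7 versus v6 (`faceOblRM_negBTA₀`, p319044): the box-width binders carry the level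
# floor `j₀ ≤ j` (repair D1) and the kit-excess binder `hR₁k` reads the face regions' planar diameter `m` (fineNb2's `hdiam`) and a generic zone depth `ρZ`
# (repair D2), so that layer (b) can serve it by `Rex_fat_le_RπA_sub` exactly as the (R) column does.
builds on p205010 (kernel theorem, internal audit signed; external expert review pending) — nothing in this file uses p205010; no claim about the open node.
Lane `prim-bschramm`, seat `prim-hp-8` (gen 36); helper file (`--supports stmt-CriticalPhenomena-4575 --as helper`); text HOME prim-hp-8/code/gen36/ (mk_v7.py).
* **`NegB.faceOblRM_negBTC₀`**.
[cite: KozmaNitzan2024, §4 Lemma 10 (pp. 17–21), Lemma 12 (pp. 23–25), Theorem 6 (pp. 25–31)] [cite: MartineauTassion2017, §4.3 Lemma 4.2]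
v9 note: v9 (hp-8 g36, 2026-08-22 09:15Z): the y′-face numbers and kit rooms read their OWN half-widths `qB′ qB₃′` (level-units landing half-width, α-units x-run start half-width) — v8 shared `qB qB₃` with the x-face (α-units landing, level-units y′-run start `≥ W ≈ n_Lℓ_L/U`), a units mismatch that breaks the y′-face floors FT5/FT6/FL1/FL2 when `ℓ_L ≫ Kq·n_L`.
-/

noncomputable section

open scoped Classical ENNReal

namespace Summit.CriticalPhenomena.PercolationContinuityZ3.Theorems.Transplant

namespace PlanarSkeletonNeg

namespace NegB

open MeasureTheory Literature.Probability.Percolation Literature.Probability.LatticeModels SimpleGraph KNCells KNLevels GadgetSystem Contour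
open Literature.Probability.Percolation.KozmaNitzan
open Literature.Probability.Percolation.KozmaNitzan.Cells (oth sgOf sgOf_sign stepVec_apply_fst)
open Literature.Barriers.CriticalPhenomena (graphBall mem_graphBall_self graphBall_mono)
open BoxProdZ2 (ConcRadiiG Erad Frad nQ nS)
open ChainPlanar ChainPara
open Skel (winGraph routeW excess WinStepData)
open SkelI (tanOff)
open TwoAxis.Para (modulus detD rep₂)
open SkelConc (Consts)
open Skelφ
open Neg

variable {κ : Consts} {V : Type} [DecidableEq V] [Countable V] {G : SimpleGraph V} [G.LocallyFinite] {Φ : PlanarSkeletonNeg G} {t : V}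
  {p : unitInterval} {gv fv : Neg.FSlot} {Sv : SSlot} {hC : Φ.CylSubcritical p} {Pv : PSlot} {O : Skelφ.StepI.OutO V} {q : unitInterval}

set_option maxHeartbeats 800000 in
/-- **Layer (a0) of the (F) wrapper, chain v7, at the (ζ′) tuple** (see the module docstring). [cite: KozmaNitzan2024, §4 Lemma 10 (pp. 17–21), Lemma 12 (pp. 23–25)] -/
theorem faceOblRM_negBTC₀
    (hb₀ : ∀ i, (b0TA κ Φ t p O.merged (gOf κ Φ t p O gv) (fOf κ Φ t p O fv)) i ≤ 3 * (fcellsA κ Φ t p O.merged (gOf κ Φ t p O gv) (fOf κ Φ t p O fv)).r i) (hb1 : ∀ i, 1 ≤ (b0TA κ Φ t p O.merged (gOf κ Φ t p O gv) (fOf κ Φ t p O fv)) i) (hc₀ : 0 < (prFA κ Φ t p O.merged (gOf κ Φ t p O gv) (fOf κ Φ t p O fv)).c₀)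
    (hc₁ : 0 < (prFA κ Φ t p O.merged (gOf κ Φ t p O gv) (fOf κ Φ t p O fv)).c₁)
    (hDd : (prFA κ Φ t p O.merged (gOf κ Φ t p O gv) (fOf κ Φ t p O fv)).D = detD (prFA κ Φ t p O.merged (gOf κ Φ t p O gv) (fOf κ Φ t p O fv)).A (prFA κ Φ t p O.merged (gOf κ Φ t p O gv) (fOf κ Φ t p O fv)).n (prFA κ Φ t p O.merged (gOf κ Φ t p O gv) (fOf κ Φ t p O fv)).h (prFA κ Φ t p O.merged (gOf κ Φ t p O gv) (fOf κ Φ t p O fv)).vα (prFA κ Φ t p O.merged (gOf κ Φ t p O gv) (fOf κ Φ t p O fv)).vβ) (hD : 0 < (prFA κ Φ t p O.merged (gOf κ Φ t p O gv) (fOf κ Φ t p O fv)).D) (hL0 : (prFA κ Φ t p O.merged (gOf κ Φ t p O gv) (fOf κ Φ t p O fv)).c₀ * (prFA κ Φ t p O.merged (gOf κ Φ t p O gv) (fOf κ Φ t p O fv)).L 0 + 2 ≤ (prFA κ Φ t p O.merged (gOf κ Φ t p O gv) (fOf κ Φ t p O fv)).D) (hL1 : (prFA κ Φ t p O.merged (gOf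 κ Φ t p O gv) (fOf κ Φ t p O fv)).c₁ * (prFA κ Φ t p O.merged (gOf κ Φ t p O gv) (fOf κ Φ t p O fv)).L 1 + 2 ≤ (prFA κ Φ t p O.merged (gOf κ Φ t p O gv) (fOf κ Φ t p O fv)).D)
    (hgap : ∀ n, 1 ≤ (Skelφ.Prm.gap (Sv κ Φ t p O.merged (gOf κ Φ t p O gv) (fOf κ Φ t p O fv) q)) n) (hgap20 : ∀ n, 20 * (fcellsA κ Φ t p O.merged (gOf κ Φ t p O gv) (fOf κ Φ t p O fv)).rmax ≤ (Skelφ.Prm.gap (Sv κ Φ t p O.merged (gOf κ Φ t p O gv) (fOf κ Φ t p O fv) q)) n) {c : ℕ} (hgapc : ∀ n, c ≤ (Skelφ.Prm.gap (Sv κ Φ t p O.merged (gOf κ Φ t p O gv) (fOf κ Φ t p O fv) q)) n) (hE₀ : 2 ≤ (Skelφ.Prm.E₀ (Sv κ Φ t p O.merged (gOf κ Φ t p O gv) (fOf κ Φ t p O fv) q))) (hL' : 1 ≤ (Skelφ.Prm.Lp (Sv κ Φ t p O.merged (gOf κ Φ t p O gv) (fOf κ Φ t p O fv) q)))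
    (hoff : ∀ x : Site 2, (offNA κ Φ t p O.merged (gOf κ Φ t p O gv) (fOf κ Φ t p O fv)) x ≤ c * ((x 0).natAbs + (x 1).natAbs) + 1)
    (hoffN : ∀ x : Site 2, (rep₂ (prFA κ Φ t p O.merged (gOf κ Φ t p O gv) (fOf κ Φ t p O fv)).A (prFA κ Φ t p O.merged (gOf κ Φ t p O gv) (fOf κ Φ t p O fv)).n (prFA κ Φ t p O.merged (gOf κ Φ t p O gv) (fOf κ Φ t p O fv)).h (prFA κ Φ t p O.merged (gOf κ Φ t p O gv) (fOf κ Φ t p O fv)).vα (prFA κ Φ t p O.merged (gOf κ Φ t p O gv) (fOf κ Φ t p O fv)).vβ (prFA κ Φ t p O.merged (gOf κ Φ t p O gv) (fOf κ Φ t p O fv)).c₀ (prFA κ Φ t p O.merged (gOf κ Φ t p O gv) (fOf κ Φ t p O fv)).c₁ ((fcellsA κ Φ t p O.merged (gOf κ Φ t p O gv) (fOf κ Φ t p O fv)).cen x) 0).natAbs +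
      (rep₂ (prFA κ Φ t p O.merged (gOf κ Φ t p O gv) (fOf κ Φ t p O fv)).A (prFA κ Φ t p O.merged (gOf κ Φ t p O gv) (fOf κ Φ t p O fv)).n (prFA κ Φ t p O.merged (gOf κ Φ t p O gv) (fOf κ Φ t p O fv)).h (prFA κ Φ t p O.merged (gOf κ Φ t p O gv) (fOf κ Φ t p O fv)).vα (prFA κ Φ t p O.merged (gOf κ Φ t p O gv) (fOf κ Φ t p O fv)).vβ (prFA κ Φ t p O.merged (gOf κ Φ t p O gv) (fOf κ Φ t p O fv)).c₀ (prFA κ Φ t p O.merged (gOf κ Φ t p O gv) (fOf κ Φ t p O fv)).c₁ ((fcellsA κ Φ t p O.merged (gOf κ Φ t p O gv) (fOf κ Φ t p O fv)).cen x) 1).natAbs + 1 ≤ (offNA κ Φ t p O.merged (gOf κ Φ t p O gv) (fOf κ Φ t p O fv)) x)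
    (Rlev N M : ℕ) (hRlev : ∀ i, Rlev + 4 ≤ 10 * (fcellsA κ Φ t p O.merged (gOf κ Φ t p O gv) (fOf κ Φ t p O fv)).s i) (hRlev' : ∀ i, Rlev + 4 ≤ 3 * (fcellsA κ Φ t p O.merged (gOf κ Φ t p O gv) (fOf κ Φ t p O fv)).r i)
    (aw : MDir → ℕ) {k₀ : ℤ} {kF : Fin 2 → ℤ} (hk₀ : ∀ I, (prFA κ Φ t p O.merged (gOf κ Φ t p O gv) (fOf κ Φ t p O fv)).rdN I ((prFA κ Φ t p O.merged (gOf κ Φ t p O gv) (fOf κ Φ t p O fv)).bOf I) ≤ (prFA κ Φ t p O.merged (gOf κ Φ t p O gv) (fOf κ Φ t p O fv)).rdK I ((prFA κ Φ t p O.merged (gOf κ Φ t p O gv) (fOf κ Φ t p O fv)).bOf I) * k₀)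
    (hk₀' : ∀ i, 3 * ((fcellsA κ Φ t p O.merged (gOf κ Φ t p O gv) (fOf κ Φ t p O fv)).r i : ℤ) + k₀ + 3 ≤ 5 * (fcellsA κ Φ t p O.merged (gOf κ Φ t p O gv) (fOf κ Φ t p O fv)).r i)
    (hroomF : ∀ du : MDir,
      (prFA κ Φ t p O.merged (gOf κ Φ t p O gv) (fOf κ Φ t p O fv)).Mabs * (aw du + Rlev + 1) + (prFA κ Φ t p O.merged (gOf κ Φ t p O gv) (fOf κ Φ t p O fv)).rdN du.1 ((prFA κ Φ t p O.merged (gOf κ Φ t p O gv) (fOf κ Φ t p O fv)).bOf du.1) * (Rlev + 2) * (prFA κ Φ t p O.merged (gOf κ Φ t p O gv) (fOf κ Φ t p O fv)).D ≤ (prFA κ Φ t p O.merged (gOf κ Φ t p O gv) (fOf κ Φ t p O fv)).rdK du.1 ((prFA κ Φ t p O.merged (gOf κ Φ t p O gv) (fOf κ Φ t p O fv)).bOf du.1) * kF du.1 * (prFA κ Φ t p O.merged (gOf κ Φ t p O gv) (fOf κ Φ t p O fv)).D)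
    (hkF : ∀ I, kF I + 3 ≤ 5 * ((fcellsA κ Φ t p O.merged (gOf κ Φ t p O gv) (fOf κ Φ t p O fv)).r (oth I) : ℤ))
    (haw : ∀ du : MDir, ((prFA κ Φ t p O.merged (gOf κ Φ t p O gv) (fOf κ Φ t p O fv)).rdK 1 ((prFA κ Φ t p O.merged (gOf κ Φ t p O gv) (fOf κ Φ t p O fv)).bOf du.1) * ((fcellsA κ Φ t p O.merged (gOf κ Φ t p O gv) (fOf κ Φ t p O fv)).faceExt du 0 + 1) + (prFA κ Φ t p O.merged (gOf κ Φ t p O gv) (fOf κ Φ t p O fv)).rdK 0 ((prFA κ Φ t p O.merged (gOf κ Φ t p O gv) (fOf κ Φ t p O fv)).bOf du.1) * ((fcellsA κ Φ t p O.merged (gOf κ Φ t p O gv) (fOf κ Φ t p O fv)).faceExt du 1 + 1)) * (prFA κ Φ t p O.merged (gOf κ Φ t p O gv) (fOf κ Φ t p O fv)).D ≤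
      (prFA κ Φ t p O.merged (gOf κ Φ t p O gv) (fOf κ Φ t p O fv)).Mabs * (aw du + 1))
    (hcount : 1 / (1 - (q : ℝ)) ^ (Φ.Δ * N) ≤ κ.δ₂ * ((Finset.Icc (M + 1) Rlev).card : ℝ))
    {η : ℝ} (hη : η ≤ κ.δ / 2) (R₁ : ℕ → ℕ) {m : ℕ}
    (hR₁ : ∀ ρ R', R₁ ρ ≤ R' → ∀ (Rw : ℕ) (D' A' : Finset V), (∀ d ∈ D', d ∈ graphBall G t Rw) →
      (∀ d ∈ D', ∀ d' ∈ D', (φL κ Φ t p O.D O.DT O.ori (gOf κ Φ t p O gv) (fOf κ Φ t p O fv)) d - (φL κ Φ t p O.D O.DT O.ori (gOf κ Φ t p O gv) (fOf κ Φ t p O fv)) d' ∈ box 2 m) → A' ⊆ D' → (∀ a ∈ A', a ∈ graphBall G t (ρ + 1)) →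
        (bondPercolation G q).real (excess G t R' D' A') ≤ η)
    (hdiam : ∀ b' : Fin 2, ((prFA κ Φ t p O.merged (gOf κ Φ t p O gv) (fOf κ Φ t p O fv)).rdK 1 b' + (prFA κ Φ t p O.merged (gOf κ Φ t p O gv) (fOf κ Φ t p O fv)).rdK 0 b') * ((50 * (fcellsA κ Φ t p O.merged (gOf κ Φ t p O gv) (fOf κ Φ t p O fv)).rmax : ℕ) + 1) * (prFA κ Φ t p O.merged (gOf κ Φ t p O gv) (fOf κ Φ t p O fv)).D ≤ (prFA κ Φ t p O.merged (gOf κ Φ t p O gv) (fOf κ Φ t p O fv)).Mabs * (m + 1))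
    (hgapR : ∀ ρ, c + 2 * (Skelφ.Prm.Lp (Sv κ Φ t p O.merged (gOf κ Φ t p O gv) (fOf κ Φ t p O fv) q)) + R₁ ρ + 2 ≤ (Skelφ.Prm.gap (Sv κ Φ t p O.merged (gOf κ Φ t p O gv) (fOf κ Φ t p O fv) q)) ρ)
    -- the binders of the keystone `hkits_faceSteps_of_nums6` (kit / route / Λ / numbers)
        (hA0 : 0 < (prFA κ Φ t p O.merged (gOf κ Φ t p O gv) (fOf κ Φ t p O fv)).A) {nL : ℕ} (hnL : 1 ≤ nL) (hvL : |(prFA κ Φ t p O.merged (gOf κ Φ t p O gv) (fOf κ Φ t p O fv)).vα| ≤ nL)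
    (hmf : 0 ≤ modulus nL (prFA κ Φ t p O.merged (gOf κ Φ t p O gv) (fOf κ Φ t p O fv)).h (prFA κ Φ t p O.merged (gOf κ Φ t p O gv) (fOf κ Φ t p O fv)).vα (prFA κ Φ t p O.merged (gOf κ Φ t p O gv) (fOf κ Φ t p O fv)).vβ)
    {nFc : Fin 2 → ℕ} (hnC : ∀ I, (nFc I : ℤ) ≤ (prFA κ Φ t p O.merged (gOf κ Φ t p O gv) (fOf κ Φ t p O fv)).cOf I * |(prFA κ Φ t p O.merged (gOf κ Φ t p O gv) (fOf κ Φ t p O fv)).A| * |(prFA κ Φ t p O.merged (gOf κ Φ t p O gv) (fOf κ Φ t p O fv)).lvGen I ((prFA κ Φ t p O.merged (gOf κ Φ t p O gv) (fOf κ Φ t p O fv)).bOf I)|)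
    (hU3 : ∀ I, (prFA κ Φ t p O.merged (gOf κ Φ t p O gv) (fOf κ Φ t p O fv)).D ≤ 3 * (nFc I : ℤ)) {E r : ℕ} (hδ₂ : 0 < κ.δ₂)
    -- THE ROUTE BLOCK (c-uniform; all signs)
    (B : ℤ → BridgePrm) (hB : ∀ σ' : ℤ, σ' = 1 ∨ σ' = -1 → BridgeOK (B σ')) (σhF : MDir → ℤ) (hσhF : ∀ du : MDir, σhF du = 1 ∨ σhF du = -1)
    {kq : ℕ} (hκL : (prFA κ Φ t p O.merged (gOf κ Φ t p O gv) (fOf κ Φ t p O fv)).h.natAbs ≤ kq * nL) (ℓ' R's qB Rl R'₃ qB₃ qB' qB₃' : ℕ)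
    (hlay : (nL + (prFA κ Φ t p O.merged (gOf κ Φ t p O gv) (fOf κ Φ t p O fv)).h.natAbs : ℕ) ≤ (nL : ℤ) * ℓ' + 1)
    (Rlev₁ N₁ j₀₁ j₁₁ Rlev₂ N₂ j₀₂ j₁₂ Rlev₃ N₃' j₀₃ j₁₃ : ℕ) (hRl₁ : ∀ σ' : ℤ, σ' = 1 ∨ σ' = -1 → Rlev₁ + 1 ≤ (B σ').R') (hRl₂ : Rlev₂ + 1 ≤ R's) (hRl₃ : Rlev₃ + 1 ≤ R'₃)
    (hj₁ : j₁₁ ≤ Rlev₁) (hj₂ : j₁₂ ≤ Rlev₂) (hj₃ : j₁₃ ≤ Rlev₃)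
    (hB0 : ∀ σ' : ℤ, σ' = 1 ∨ σ' = -1 → Finset.Icc (Skelφ.pt nL (σ' * (prFA κ Φ t p O.merged (gOf κ Φ t p O gv) (fOf κ Φ t p O fv)).h)) (Skelφ.pt nL (σ' * (prFA κ Φ t p O.merged (gOf κ Φ t p O gv) (fOf κ Φ t p O fv)).h + ℓ')) ⊆ Finset.Icc (B σ').B₀lo (B σ').B₀hi) (hRlr : Rl ≤ r)
    -- the near-`c` block READ BY THE TWO LATTICE FUNCTIONALS (L-F2): bridge regions (every frame sign), hop prism, zone box, fine extents `kA`
    {Λ₀ Λ₁ : ℤ} {kA : Fin 2 → ℤ}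
    (hΛR : ∀ σ' : ℤ, σ' = 1 ∨ σ' = -1 → ∀ x ∈ Finset.Icc (B σ').regionLo (B σ').regionHi, |(prFA κ Φ t p O.merged (gOf κ Φ t p O gv) (fOf κ Φ t p O fv)).vβ * (σ' * x 0) - (prFA κ Φ t p O.merged (gOf κ Φ t p O gv) (fOf κ Φ t p O fv)).vα * x 1| ≤ Λ₀ ∧ |(nL : ℤ) * x 1 - (prFA κ Φ t p O.merged (gOf κ Φ t p O gv) (fOf κ Φ t p O fv)).h * (σ' * x 0)| ≤ Λ₁)
    (hΛQ0 : modulus nL (prFA κ Φ t p O.merged (gOf κ Φ t p O gv) (fOf κ Φ t p O fv)).h (prFA κ Φ t p O.merged (gOf κ Φ t p O gv) (fOf κ Φ t p O fv)).vα (prFA κ Φ t p O.merged (gOf κ Φ t p O gv) (fOf κ Φ t p O fv)).vβ + (nL : ℤ) * ((3 * ℓ' : ℕ) : ℤ) ≤ Λ₀) (hΛQ1 : (nL : ℤ) * ((3 * ℓ' : ℕ) : ℤ) ≤ Λ₁) {Mz : ℕ}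
    (hΛZ : (|(prFA κ Φ t p O.merged (gOf κ Φ t p O gv) (fOf κ Φ t p O fv)).vβ| + |(prFA κ Φ t p O.merged (gOf κ Φ t p O gv) (fOf κ Φ t p O fv)).vα|) * (Mz : ℤ) ≤ Λ₀ ∧ ((nL : ℤ) + |(prFA κ Φ t p O.merged (gOf κ Φ t p O gv) (fOf κ Φ t p O fv)).h|) * (Mz : ℤ) ≤ Λ₁)
    (hkA0 : (prFA κ Φ t p O.merged (gOf κ Φ t p O gv) (fOf κ Φ t p O fv)).c₀ * (|(prFA κ Φ t p O.merged (gOf κ Φ t p O gv) (fOf κ Φ t p O fv)).A| * Λ₀) ≤ kA 0 * (prFA κ Φ t p O.merged (gOf κ Φ t p O gv) (fOf κ Φ t p O fv)).D) (hkA1 : (prFA κ Φ t p O.merged (gOf κ Φ t p O gv) (fOf κ Φ t p O fv)).c₁ * (|(prFA κ Φ t p O.merged (gOf κ Φ t p O gv) (fOf κ Φ t p O fv)).A| * Λ₁) ≤ kA 1 * (prFA κ Φ t p O.merged (gOf κ Φ t p O gv) (fOf κ Φ t p O fv)).D)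
    {kb : ℕ} (hkbMz : (Mz : ℤ) ≤ kb) (hπ1 : ∀ σ' : ℤ, σ' = 1 ∨ σ' = -1 → ((B σ').core1Lo 0).natAbs + ((B σ').core1Lo 1).natAbs ≤ r)
    (hclr₁ : ∀ σ' : ℤ, σ' = 1 ∨ σ' = -1 → (kb : ℤ) < (B σ').B₀lo 0 - (B σ').R' - (B σ').pr)
    {δ ηk : ℝ} (hδ : 0 < δ) (hδ1 : δ ≤ 1) (nB : ℕ)
    -- the inner-chain fact UP TO THE LENGTH BUDGET `nF` (p3-g11 2026-08-22T02:23:54Z; the wrapper discharges it by `ChainFactF` at `n ≤ LfA K₀`)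
    (hchain : ∀ (c : V) (Nr N₃ : ℕ), 0 + 1 + Nr + 1 + N₃ ≤ nB → ∀ (W : Sym2 V → unitInterval) (s : Fin (0 + 1 + Nr + 1 + N₃ + 1) → TStep (winGraph G c r))
      (T' : Fin (0 + 1 + Nr + 1 + N₃ + 1) → Finset V) (η : ℝ),
      (∀ i, (s i).L.o = (s 0).L.o) →
      (∀ i : Fin (0 + 1 + Nr + 1 + N₃), T' (Fin.castSucc i) ⊆ (s i.succ).L.X 0) →
      (∀ i, T' i ⊆ (s i).T) →
      (∀ i, (s i).KitsAt W q Φ.Δ δ) →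
      η ≤ δ / 2 →
      (∀ i, (prodBernoulli W).real (⋃ t ∈ (s i).T \ T' i, openConn (s 0).L.o t) ≤ η) →
      1 - δ < (prodBernoulli W).real (s 0).L.reachB →
        1 - κ.δ₂ ^ 2 < (prodBernoulli W).real (⋃ t ∈ T' (Fin.last (0 + 1 + Nr + 1 + N₃)), openConn (s 0).L.o t))
    (hcount₁ : 1 / (1 - (q : ℝ)) ^ (Φ.Δ * N₁) ≤ δ * ((Finset.Icc j₀₁ j₁₁).card : ℝ))
    (hcount₂ : 1 / (1 - (q : ℝ)) ^ (Φ.Δ * N₂) ≤ δ * ((Finset.Icc j₀₂ j₁₂).card : ℝ))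
    (hcount₃ : 1 / (1 - (q : ℝ)) ^ (Φ.Δ * N₃') ≤ δ * ((Finset.Icc j₀₃ j₁₃).card : ℝ))
    (hηk : ηk ≤ δ / 2)
    (Pb Pr : ApronPrm) {Rs Kmaxb KCmaxb Kmaxr KCmaxr rsb rsr cSb cSr cU r₁ r₂ Rb : ℕ}
    (hPNb : 1 ≤ Pb.N) (hAb : Pb.A = (Mz : ℤ) + 2)
    (hd1b : Pb.W + Pb.ℓ ≤ Pb.d) (hD1b : Pb.W + Pb.ℓ + Pb.d + 2 ≤ shellD Pb) (hD2b : Pb.ℓ + Rs + Pb.d + 3 ≤ shellD Pb) (hDρb : Rs + 1 ≤ shellD Pb)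
    (hℓb : 1 ≤ Pb.ℓ) (hWb : Rs + Pb.ℓ ≤ Pb.W) (hKmaxb : shellD Pb + Pb.W ≤ Kmaxb) (hKCmaxb : shellD Pb + Mz + 1 ≤ KCmaxb)
    (hR'b : cylRadMax G (φL κ Φ t p O.D O.DT O.ori (gOf κ Φ t p O gv) (fOf κ Φ t p O fv)) Φ.types Pb.ℓ (Rs + KCmaxb + (Pb.W + Kmaxb)) ≤ Pb.R')
    (hwideb : ∀ σ' : ℤ, σ' = 1 ∨ σ' = -1 → ∀ j, j₀₁ ≤ j → j ≤ j₁₁ → ∀ i, ((B σ').B₀lo - (j : Site 2)) i + 2 * tanOff Pb.ℓs Pb.M ≤ ((B σ').B₀hi + (j : Site 2)) i)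
    (hdwb : ∀ σ' : ℤ, σ' = 1 ∨ σ' = -1 → ∀ j, j₀₁ ≤ j → j ≤ j₁₁ → ∀ i, ((B σ').B₀lo - (j : Site 2)) i + (Pb.d + 2 : ℕ) ≤ ((B σ').B₀hi + (j : Site 2)) i)
    (hDwb : ∀ σ' : ℤ, σ' = 1 ∨ σ' = -1 → ∀ j, j₀₁ ≤ j → j ≤ j₁₁ → ∀ i, ((B σ').B₀lo - (j : Site 2)) i + ((shellD Pb + 1 + Pb.d + KCmaxb + Rs : ℕ) : ℤ) ≤ ((B σ').B₀hi + (j : Site 2)) i)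
    (hTb : (Pb.W : ℤ) + Kmaxb + Pb.ℓ + 1 ≤ tanOff Pb.ℓs Pb.M) (hT'b : (shellD Pb : ℤ) + KCmaxb + Rs ≤ tanOff Pb.ℓs Pb.M)
    (hr₀b : Pb.N * (tanOff Pb.ℓs Pb.M + 2) + Pb.N * Pb.d + (Pb.W + Kmaxb + Pb.R') + (KCmaxb + Rs) ≤ Pb.r₀) (hRb₀ : Pb.r₀ ≤ r)
    (hrsb : 2 * (1 + Pb.N * (tanOff Pb.ℓs Pb.M + 2) + Pb.N * Pb.d + (Pb.W + Kmaxb + Pb.R') + (KCmaxb + Rs)) ≤ rsb)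
    (hcSb : (Pb.N + 1) * (tanOff Pb.ℓs Pb.M + 1) + (Pb.N + 1) * Pb.d + (2 * Pb.W + 1) * (Kmaxb + 1) * (Φ.Δ + 1) ^ Pb.R' ≤ cSb)
    (hEb : ∀ σ' : ℤ, σ' = 1 ∨ σ' = -1 → j₁₁ + (Pb.N * (tanOff Pb.ℓs Pb.M + 1) + Pb.N * Pb.d + KCmaxb) ≤ (B σ').R')
    (hreachb : r₁ + (Pb.N * (tanOff Pb.ℓs Pb.M + 1) + Pb.N * Pb.d + KCmaxb) ≤ Pb.r₀) (hr₁ : Rb ≤ r₁) (hr₁R : r₁ ≤ r)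
    (hPNr : kq + 3 ≤ Pr.N) (hAr : Pr.A = (Mz + 1 : ℕ) * (shearUnit nL (prFA κ Φ t p O.merged (gOf κ Φ t p O gv) (fOf κ Φ t p O fv)).h : ℤ) + 1)
    (hd1r : Pr.W + Pr.ℓ ≤ Pr.d) (hD1r : Pr.W + Pr.ℓ + Pr.d + 2 ≤ shellD Pr) (hD2r : Pr.ℓ + Rs + Pr.d + 3 ≤ shellD Pr) (hDρr : Rs + 1 ≤ shellD Pr)
    (hℓr : 1 ≤ Pr.ℓ) (hWr : Rs + Pr.ℓ ≤ Pr.W) (hKmaxr : (shellD Pr + Pr.W) * (kq + 1) ≤ Kmaxr) (hKCmaxr : (shellD Pr + Mz + 1) * (kq + 1) ≤ KCmaxr)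
    (hR'r : cylRadMax G (φL κ Φ t p O.D O.DT O.ori (gOf κ Φ t p O gv) (fOf κ Φ t p O fv)) Φ.types Pr.ℓ (Rs + KCmaxr + (Pr.W + Kmaxr)) ≤ Pr.R')
    (hwider : ∀ Nr, ∀ k ≤ Nr, ∀ j, j₀₂ ≤ j → j ≤ j₁₂ → ∀ i, ((xRunSched nL ℓ' (prFA κ Φ t p O.merged (gOf κ Φ t p O gv) (fOf κ Φ t p O fv)).h R's qB Nr).lo k - (j : Site 2)) i + 2 * tanOff Pr.ℓs Pr.M ≤
      ((xRunSched nL ℓ' (prFA κ Φ t p O.merged (gOf κ Φ t p O gv) (fOf κ Φ t p O fv)).h R's qB Nr).hi k + (j : Site 2)) i)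
    (hdwr : ∀ Nr, ∀ k ≤ Nr, ∀ j, j₀₂ ≤ j → j ≤ j₁₂ → ∀ i, ((xRunSched nL ℓ' (prFA κ Φ t p O.merged (gOf κ Φ t p O gv) (fOf κ Φ t p O fv)).h R's qB Nr).lo k - (j : Site 2)) i + (Pr.d + 2 : ℕ) ≤
      ((xRunSched nL ℓ' (prFA κ Φ t p O.merged (gOf κ Φ t p O gv) (fOf κ Φ t p O fv)).h R's qB Nr).hi k + (j : Site 2)) i)
    (hDwr : ∀ Nr, ∀ k ≤ Nr, ∀ j, j₀₂ ≤ j → j ≤ j₁₂ → ∀ i, ((xRunSched nL ℓ' (prFA κ Φ t p O.merged (gOf κ Φ t p O gv) (fOf κ Φ t p O fv)).h R's qB Nr).lo k - (j : Site 2)) i + ((shellD Pr + 1 + Pr.d + KCmaxr + Rs : ℕ) : ℤ) ≤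
      ((xRunSched nL ℓ' (prFA κ Φ t p O.merged (gOf κ Φ t p O gv) (fOf κ Φ t p O fv)).h R's qB Nr).hi k + (j : Site 2)) i)
    (hwidey : ∀ N₃, ∀ k ≤ N₃, ∀ j, j₀₃ ≤ j → j ≤ j₁₃ → ∀ i, ((yRunSched hnL hvL hlay R'₃ qB₃ N₃).lo k - (j : Site 2)) i + 2 * tanOff Pr.ℓs Pr.M ≤
      ((yRunSched hnL hvL hlay R'₃ qB₃ N₃).hi k + (j : Site 2)) i)
    (hdwy : ∀ N₃, ∀ k ≤ N₃, ∀ j, j₀₃ ≤ j → j ≤ j₁₃ → ∀ i, ((yRunSched hnL hvL hlay R'₃ qB₃ N₃).lo k - (j : Site 2)) i + (Pr.d + 2 : ℕ) ≤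
      ((yRunSched hnL hvL hlay R'₃ qB₃ N₃).hi k + (j : Site 2)) i)
    (hDwy : ∀ N₃, ∀ k ≤ N₃, ∀ j, j₀₃ ≤ j → j ≤ j₁₃ → ∀ i, ((yRunSched hnL hvL hlay R'₃ qB₃ N₃).lo k - (j : Site 2)) i + ((shellD Pr + 1 + Pr.d + KCmaxr + Rs : ℕ) : ℤ) ≤
      ((yRunSched hnL hvL hlay R'₃ qB₃ N₃).hi k + (j : Site 2)) i)
    (hwiderY : ∀ Nr, ∀ k ≤ Nr, ∀ j, j₀₂ ≤ j → j ≤ j₁₂ → ∀ i, ((yRunSched hnL hvL hlay R's qB' Nr).lo k - (j : Site 2)) i + 2 * tanOff Pr.ℓs Pr.M ≤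
      ((yRunSched hnL hvL hlay R's qB' Nr).hi k + (j : Site 2)) i)
    (hdwrY : ∀ Nr, ∀ k ≤ Nr, ∀ j, j₀₂ ≤ j → j ≤ j₁₂ → ∀ i, ((yRunSched hnL hvL hlay R's qB' Nr).lo k - (j : Site 2)) i + (Pr.d + 2 : ℕ) ≤
      ((yRunSched hnL hvL hlay R's qB' Nr).hi k + (j : Site 2)) i)
    (hDwrY : ∀ Nr, ∀ k ≤ Nr, ∀ j, j₀₂ ≤ j → j ≤ j₁₂ → ∀ i, ((yRunSched hnL hvL hlay R's qB' Nr).lo k - (j : Site 2)) i + ((shellD Pr + 1 + Pr.d + KCmaxr + Rs : ℕ) : ℤ) ≤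
      ((yRunSched hnL hvL hlay R's qB' Nr).hi k + (j : Site 2)) i)
    (hwideyY : ∀ N₃, ∀ k ≤ N₃, ∀ j, j₀₃ ≤ j → j ≤ j₁₃ → ∀ i, ((xRunSched nL ℓ' (prFA κ Φ t p O.merged (gOf κ Φ t p O gv) (fOf κ Φ t p O fv)).h R'₃ qB₃' N₃).lo k - (j : Site 2)) i + 2 * tanOff Pr.ℓs Pr.M ≤
      ((xRunSched nL ℓ' (prFA κ Φ t p O.merged (gOf κ Φ t p O gv) (fOf κ Φ t p O fv)).h R'₃ qB₃' N₃).hi k + (j : Site 2)) i)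
    (hdwyY : ∀ N₃, ∀ k ≤ N₃, ∀ j, j₀₃ ≤ j → j ≤ j₁₃ → ∀ i, ((xRunSched nL ℓ' (prFA κ Φ t p O.merged (gOf κ Φ t p O gv) (fOf κ Φ t p O fv)).h R'₃ qB₃' N₃).lo k - (j : Site 2)) i + (Pr.d + 2 : ℕ) ≤
      ((xRunSched nL ℓ' (prFA κ Φ t p O.merged (gOf κ Φ t p O gv) (fOf κ Φ t p O fv)).h R'₃ qB₃' N₃).hi k + (j : Site 2)) i)
    (hDwyY : ∀ N₃, ∀ k ≤ N₃, ∀ j, j₀₃ ≤ j → j ≤ j₁₃ → ∀ i, ((xRunSched nL ℓ' (prFA κ Φ t p O.merged (gOf κ Φ t p O gv) (fOf κ Φ t p O fv)).h R'₃ qB₃' N₃).lo k - (j : Site 2)) i + ((shellD Pr + 1 + Pr.d + KCmaxr + Rs : ℕ) : ℤ) ≤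
      ((xRunSched nL ℓ' (prFA κ Φ t p O.merged (gOf κ Φ t p O gv) (fOf κ Φ t p O fv)).h R'₃ qB₃' N₃).hi k + (j : Site 2)) i)
    (hTr : (Pr.W : ℤ) + Kmaxr + Pr.ℓ + 1 ≤ tanOff Pr.ℓs Pr.M) (hT'r : (shellD Pr : ℤ) + KCmaxr + Rs ≤ tanOff Pr.ℓs Pr.M)
    (hr₀r : Pr.N * (tanOff Pr.ℓs Pr.M + 2) + Pr.N * Pr.d + (Pr.W + Kmaxr + Pr.R') + (KCmaxr + Rs) ≤ Pr.r₀) (hRr₀ : Pr.r₀ ≤ r)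
    (hrsr : 2 * (1 + Pr.N * (tanOff Pr.ℓs Pr.M + 2) + Pr.N * Pr.d + (Pr.W + Kmaxr + Pr.R') + (KCmaxr + Rs)) ≤ rsr)
    (hcSr : (Pr.N + 1) * (tanOff Pr.ℓs Pr.M + 1) + (Pr.N + 1) * Pr.d + (2 * Pr.W + 1) * (Kmaxr + 1) * (Φ.Δ + 1) ^ Pr.R' ≤ cSr)
    (hEr : j₁₂ + (Pr.N * (tanOff Pr.ℓs Pr.M + 1) + Pr.N * Pr.d + KCmaxr) ≤ R's)
    (hEy : j₁₃ + (Pr.N * (tanOff Pr.ℓs Pr.M + 1) + Pr.N * Pr.d + KCmaxr) ≤ R'₃)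
    (hreachr : r₂ + (Pr.N * (tanOff Pr.ℓs Pr.M + 1) + Pr.N * Pr.d + KCmaxr) ≤ Pr.r₀) (hr₂ : Rl ≤ r₂) (hr₂R : r₂ ≤ r)
    (QK : ShortPcO V) (hRgRs : ∀ c', QK.RS c' ≤ Rs) (hRgcard : ∀ c', (RgO G (φL κ Φ t p O.D O.DT O.ori (gOf κ Φ t p O gv) (fOf κ Φ t p O fv)) QK c').card ≤ cU) (hcU1 : 1 ≤ cU)
    (hnSK : ∀ c', 22 * Mz + 58 ≤ QK.nS c') (hκSK : ∀ c', |QK.hS c'| ≤ 10 * (QK.nS c' : ℤ)) (hℓSK : ∀ c', 24 * Mz + 64 ≤ QK.ℓS c')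
    (hκL10 : |(prFA κ Φ t p O.merged (gOf κ Φ t p O gv) (fOf κ Φ t p O fv)).h| ≤ 10 * (nL : ℤ))
    (Λc : V → ℕ → Finset V) (kz : ℕ) (hkn : ∀ c', Λc c' kz ⊆ Λc c' Mz) (hΛ : ∀ c', ∀ v ∈ Λc c' Mz, v ∈ RgO G (φL κ Φ t p O.D O.DT O.ori (gOf κ Φ t p O gv) (fOf κ Φ t p O fv)) QK c' ∧ (φL κ Φ t p O.D O.DT O.ori (gOf κ Φ t p O gv) (fOf κ Φ t p O fv)) v - (φL κ Φ t p O.D O.DT O.ori (gOf κ Φ t p O gv) (fOf κ Φ t p O fv)) c' ∈ box 2 Mz)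
    (hZ : ∀ c', (↑(Λc c' Mz) : Set V) ⊆ Skelφ.cyl (φL κ Φ t p O.D O.DT O.ori (gOf κ Φ t p O gv) (fOf κ Φ t p O fv)) c' Mz) (hMz : Mz < nL) (hclrz : (Mz + 4) * (nL + (prFA κ Φ t p O.merged (gOf κ Φ t p O gv) (fOf κ Φ t p O fv)).h.natAbs) ≤ nL * (ℓ' + 1))
    (hcz : ∀ c, c ∈ Λc c kz) (hzconn : ∀ c, ∀ s ∈ Λc c kz, PathIn G (↑(Λc c kz) : Set V) c s) (hRsr : Rs ≤ r)
    {ρZ : ℕ} (hZρ : ∀ c', ∀ s ∈ Λc c' kz, s ∈ graphBall G c' ρZ) (hρr : ρZ ≤ r)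
    (hZU : ∀ c, Λc c kz ⊆ pgramPrismFin G (φL κ Φ t p O.D O.DT O.ori (gOf κ Φ t p O gv) (fOf κ Φ t p O fv)) c nL (prFA κ Φ t p O.merged (gOf κ Φ t p O gv) (fOf κ Φ t p O fv)).h (3 * ℓ') Rl)
    (Qb Fb : ℤ → V → Finset V)
    (hQb : ∀ σ' : ℤ, σ' = 1 ∨ σ' = -1 → ∀ c c', ∀ w ∈ Qb σ' c', w ∈ graphBall G c' Rb ∧
      rootFrame (φL κ Φ t p O.D O.DT O.ori (gOf κ Φ t p O gv) (fOf κ Φ t p O fv)) c σ' w ∈ Finset.Icc (rootFrame (φL κ Φ t p O.D O.DT O.ori (gOf κ Φ t p O gv) (fOf κ Φ t p O fv)) c σ' c' - (((B σ').pr : ℕ) : Site 2)) (rootFrame (φL κ Φ t p O.D O.DT O.ori (gOf κ Φ t p O gv) (fOf κ Φ t p O fv)) c σ' c' + (((B σ').pr : ℕ) : Site 2)))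
    (hFb : ∀ σ' : ℤ, σ' = 1 ∨ σ' = -1 → ∀ c c', ∀ w ∈ Fb σ' c', w ∈ Qb σ' c' ∧
      rootFrame (φL κ Φ t p O.D O.DT O.ori (gOf κ Φ t p O gv) (fOf κ Φ t p O fv)) c σ' w ∈ Finset.Icc (rootFrame (φL κ Φ t p O.D O.DT O.ori (gOf κ Φ t p O gv) (fOf κ Φ t p O fv)) c σ' c' + (B σ').dlo) (rootFrame (φL κ Φ t p O.D O.DT O.ori (gOf κ Φ t p O gv) (fOf κ Φ t p O fv)) c σ' c' + (B σ').dhi))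
    (hFZ : ∀ σ' : ℤ, σ' = 1 ∨ σ' = -1 → ∀ c', Disjoint (Fb σ' c') (Λc c' Mz))
    (kk₁ kk₂ kk₃ : ℕ) (hkN₁ : kk₁ * (Φ.Δ + 1) ^ (2 * rsb) ≤ N₁) (hkN₂ : kk₂ * (Φ.Δ + 1) ^ (2 * rsr) ≤ N₂) (hkN₃ : kk₃ * (Φ.Δ + 1) ^ (2 * rsr) ≤ N₃')
    (hk₁ : (1 - (q : ℝ) ^ (1 + Φ.Δ * cSb + cSb * cU)) ^ kk₁ ≤ δ) (hk₂ : (1 - (q : ℝ) ^ (1 + Φ.Δ * cSr + cSr * cU)) ^ kk₂ ≤ δ)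
    (hk₃ : (1 - (q : ℝ) ^ (1 + Φ.Δ * cSr + cSr * cU)) ^ kk₃ ≤ δ)
    (hzone : ∀ c', 1 - δ ^ 2 < (bondPercolation G q).real (UniqZone.zone G (Λc c') kz Mz))
    (hexitb : ∀ σ' : ℤ, σ' = 1 ∨ σ' = -1 → ∀ c' (i : Fin 2) (σ₀ : ℤˣ), 1 - δ ^ 2 < (bondPercolation G q).real
      (linkIn (↑(RgO G (φL κ Φ t p O.D O.DT O.ori (gOf κ Φ t p O gv) (fOf κ Φ t p O fv)) QK c') : Set V) (Λc c' kz) (pexRO G (φL κ Φ t p O.D O.DT O.ori (gOf κ Φ t p O gv) (fOf κ Φ t p O fv)) QK Mz Pb.A σ' i σ₀ c')))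
    (hexitr : ∀ σ' : ℤ, σ' = 1 ∨ σ' = -1 → ∀ c' (i : Fin 2) (σ₀ : ℤˣ), 1 - δ ^ 2 < (bondPercolation G q).real
      (linkIn (↑(RgO G (φL κ Φ t p O.D O.DT O.ori (gOf κ Φ t p O gv) (fOf κ Φ t p O fv)) QK c') : Set V) (Λc c' kz) (pexXO G (φL κ Φ t p O.D O.DT O.ori (gOf κ Φ t p O gv) (fOf κ Φ t p O fv)) QK Mz nL (prFA κ Φ t p O.merged (gOf κ Φ t p O gv) (fOf κ Φ t p O fv)).h Pr.A σ' i σ₀ c')))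
    (hexity : ∀ σT : ℤ, σT = 1 ∨ σT = -1 → ∀ c' (i : Fin 2) (σ₀ : ℤˣ), 1 - δ ^ 2 < (bondPercolation G q).real
      (linkIn (↑(RgO G (φL κ Φ t p O.D O.DT O.ori (gOf κ Φ t p O gv) (fOf κ Φ t p O fv)) QK c') : Set V) (Λc c' kz) (pexYO G (φL κ Φ t p O.D O.DT O.ori (gOf κ Φ t p O gv) (fOf κ Φ t p O fv)) QK Mz nL (prFA κ Φ t p O.merged (gOf κ Φ t p O gv) (fOf κ Φ t p O fv)).h Pr.A σT i σ₀ c')))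
    (hbridge : ∀ σ' : ℤ, σ' = 1 ∨ σ' = -1 → ∀ c', 1 - δ ^ 2 < (bondPercolation G q).real (linkIn (↑(Qb σ' c') : Set V) (Λc c' kz) (Fb σ' c')))
    (hlongx : ∀ σ' : ℤ, σ' = 1 ∨ σ' = -1 → ∀ c' (τ : ℤ), τ = 1 ∨ τ = -1 → 1 - δ ^ 2 < (bondPercolation G q).real
      (linkIn (pgramPrism G (φL κ Φ t p O.D O.DT O.ori (gOf κ Φ t p O gv) (fOf κ Φ t p O fv)) c' nL (prFA κ Φ t p O.merged (gOf κ Φ t p O gv) (fOf κ Φ t p O fv)).h (3 * ℓ') Rl) (Λc c' kz) (pgSideHalfW G (φL κ Φ t p O.D O.DT O.ori (gOf κ Φ t p O gv) (fOf κ Φ t p O fv)) c' nL (prFA κ Φ t p O.merged (gOf κ Φ t p O gv) (fOf κ Φ t p O fv)).h ℓ' Rl σ' (σ' * τ))))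
    (hlongy : ∀ σT : ℤ, σT = 1 ∨ σT = -1 → ∀ c' (τ : ℤ), τ = 1 ∨ τ = -1 → 1 - δ ^ 2 < (bondPercolation G q).real
      (linkIn (pgramPrism G (φL κ Φ t p O.D O.DT O.ori (gOf κ Φ t p O gv) (fOf κ Φ t p O fv)) c' nL (prFA κ Φ t p O.merged (gOf κ Φ t p O gv) (fOf κ Φ t p O fv)).h (3 * ℓ') Rl) (Λc c' kz) (pgTopPieceW G (φL κ Φ t p O.D O.DT O.ori (gOf κ Φ t p O gv) (fOf κ Φ t p O fv)) c' nL (prFA κ Φ t p O.merged (gOf κ Φ t p O gv) (fOf κ Φ t p O fv)).h ℓ' Rl σT τ (prFA κ Φ t p O.merged (gOf κ Φ t p O gv) (fOf κ Φ t p O fv)).vα)))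
    {R₁k : ℕ}
    (hR₁k : ∀ (c' : V) (R' : ℕ), R₁k ≤ R' → ∀ (Rw : ℕ) (D' B' : Finset V), (∀ d ∈ D', d ∈ graphBall G c' Rw) →
      (∀ d ∈ D', ∀ d' ∈ D', (φL κ Φ t p O.D O.DT O.ori (gOf κ Φ t p O gv) (fOf κ Φ t p O fv)) d - (φL κ Φ t p O.D O.DT O.ori (gOf κ Φ t p O gv) (fOf κ Φ t p O fv)) d' ∈ box 2 m) → B' ⊆ D' → (∀ a ∈ B', a ∈ graphBall G c' ρZ) →
        (bondPercolation G q).real (excess G c' R' D' B') ≤ ηk)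
    (hR₁b : R₁k ≤ r - Pb.r₀) (hR₁r : R₁k ≤ r - Pr.r₀)
    -- the FACE KIT: constants, exit table rooms, reach, inputs at accuracy `κ.δ₂`
    (PA : ApronPrm) {Kmax KCmax rs cS : ℕ} (hPN : 3 ≤ PA.N) (hA : PA.A = (Mz + 1 : ℕ) * (prFA κ Φ t p O.merged (gOf κ Φ t p O gv) (fOf κ Φ t p O fv)).D + 1)
    (hd1 : PA.W + PA.ℓ ≤ PA.d) (hD1 : PA.W + PA.ℓ + PA.d + 2 ≤ shellD PA) (hD2 : PA.ℓ + Rs + PA.d + 3 ≤ shellD PA) (hDρ : Rs + 1 ≤ shellD PA)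
    (hℓ : 1 ≤ PA.ℓ) (hW : Rs + PA.ℓ ≤ PA.W) (hKmax : (shellD PA + PA.W) * 3 ≤ Kmax) (hKCmax : (shellD PA + Mz + 1) * 3 ≤ KCmax)
    (hR' : cylRadMax G (φL κ Φ t p O.D O.DT O.ori (gOf κ Φ t p O gv) (fOf κ Φ t p O fv)) Φ.types PA.ℓ (Rs + KCmax + (PA.W + Kmax)) ≤ PA.R')
    (hMtan : tanOff PA.ℓs PA.M ≤ (M : ℤ) + 1) (hMd : PA.d + 2 ≤ 2 * M + 2) (hMD : shellD PA + 1 + PA.d + KCmax + Rs ≤ 2 * M + 2)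
    (hT : (PA.W : ℤ) + Kmax + PA.ℓ + 1 ≤ tanOff PA.ℓs PA.M) (hT' : (shellD PA : ℤ) + KCmax + Rs ≤ tanOff PA.ℓs PA.M)
    (hr₀ : PA.N * (tanOff PA.ℓs PA.M + 2) + PA.N * PA.d + (PA.W + Kmax + PA.R') + (KCmax + Rs) ≤ PA.r₀) (hr₀L : PA.r₀ + 1 ≤ 2 * (Skelφ.Prm.Lp (Sv κ Φ t p O.merged (gOf κ Φ t p O gv) (fOf κ Φ t p O fv) q)))
    (hrs : 2 * (1 + PA.N * (tanOff PA.ℓs PA.M + 2) + PA.N * PA.d + (PA.W + Kmax + PA.R') + (KCmax + Rs)) ≤ rs)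
    (hcS : (PA.N + 1) * (tanOff PA.ℓs PA.M + 1) + (PA.N + 1) * PA.d + (2 * PA.W + 1) * (Kmax + 1) * (Φ.Δ + 1) ^ PA.R' ≤ cS)
    (hE : Rlev + (PA.N * (tanOff PA.ℓs PA.M + 1) + PA.N * PA.d + KCmax) ≤ E)
    (hreach : r + (PA.N * (tanOff PA.ℓs PA.M + 1) + PA.N * PA.d + KCmax) ≤ PA.r₀)
    {C MK : ℕ} (hn1 : ∀ c', 1 ≤ QK.nS c') (hEq : ∀ c', ((MK : ℤ) + 1) * (QK.nS c' + |QK.hS c'|) ≤ (QK.nS c' : ℤ) * (QK.ℓS c' + 1))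
    (hM4 : 4 * C + 1 ≤ MK) (hn2 : ∀ c', 2 * C ≤ QK.nS c') {kL : Fin 2 → ℤ} (hexitR : PA.A + 2 * (prFA κ Φ t p O.merged (gOf κ Φ t p O gv) (fOf κ Φ t p O fv)).D ≤ (C : ℤ) * (prFA κ Φ t p O.merged (gOf κ Φ t p O gv) (fOf κ Φ t p O fv)).D)
    (hexitL : ∀ I, PA.A + (prFA κ Φ t p O.merged (gOf κ Φ t p O gv) (fOf κ Φ t p O fv)).climC I ((prFA κ Φ t p O.merged (gOf κ Φ t p O gv) (fOf κ Φ t p O fv)).bOf I) I + (prFA κ Φ t p O.merged (gOf κ Φ t p O gv) (fOf κ Φ t p O fv)).D ≤ kL I * (prFA κ Φ t p O.merged (gOf κ Φ t p O gv) (fOf κ Φ t p O fv)).D) (hkC : ∀ I, (kL I + 1) * (prFA κ Φ t p O.merged (gOf κ Φ t p O gv) (fOf κ Φ t p O fv)).D ≤ (C : ℤ) * ((prFA κ Φ t p O.merged (gOf κ Φ t p O gv) (fOf κ Φ t p O fv)).cOf I * (prFA κ Φ t p O.merged (gOf κ Φ t p O gv) (fOf κ Φ t p O fv)).L I))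
    (kk : ℕ) (hN : kk * (Φ.Δ + 1) ^ (2 * rs) ≤ N) (hk : (1 - (q : ℝ) ^ (1 + Φ.Δ * cS + cS * cU)) ^ kk ≤ κ.δ₂)
    (hzoneK : ∀ c', 1 - κ.δ₂ ^ 2 < (bondPercolation G q).real (UniqZone.zone G (Λc c') kz Mz))
    (hexitK : ∀ (I : Fin 2) c' (i : Fin 2) (σ₀ : ℤˣ), 1 - κ.δ₂ ^ 2 < (bondPercolation G q).real
      (linkIn (↑(RgO G (φL κ Φ t p O.D O.DT O.ori (gOf κ Φ t p O gv) (fOf κ Φ t p O fv)) QK c') : Set V) (Λc c' kz) ((prFA κ Φ t p O.merged (gOf κ Φ t p O gv) (fOf κ Φ t p O fv)).pexFO G (φL κ Φ t p O.D O.DT O.ori (gOf κ Φ t p O gv) (fOf κ Φ t p O fv)) I ((prFA κ Φ t p O.merged (gOf κ Φ t p O gv) (fOf κ Φ t p O fv)).bOf I) QK C i σ₀ c')))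
    -- THE PER-CENTRE NUMBERS (x-faces `du.1 = 0`, y′-faces `du.1 = 1`)
    (numsX : ∀ (a' : ℕ) (x : Site 2) (du : MDir) (j : ℕ) (pc : ℤ) (c' : V), du.1 = 0 → j < (fcellsA κ Φ t p O.merged (gOf κ Φ t p O gv) (fOf κ Φ t p O fv)).K → ∀ yF : V,
      (prFA κ Φ t p O.merged (gOf κ Φ t p O gv) (fOf κ Φ t p O fv)).ψ (φL κ Φ t p O.D O.DT O.ori (gOf κ Φ t p O gv) (fOf κ Φ t p O fv)) t yF = (fcellsA κ Φ t p O.merged (gOf κ Φ t p O gv) (fOf κ Φ t p O fv)).faceCen x du j → pc = relφ (φL κ Φ t p O.D O.DT O.ori (gOf κ Φ t p O gv) (fOf κ Φ t p O fv)) t yF ((prFA κ Φ t p O.merged (gOf κ Φ t p O gv) (fOf κ Φ t p O fv)).bOf du.1) →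
      (prFA κ Φ t p O.merged (gOf κ Φ t p O gv) (fOf κ Φ t p O fv)).frame (φL κ Φ t p O.D O.DT O.ori (gOf κ Φ t p O gv) (fOf κ Φ t p O fv)) t du.1 ((prFA κ Φ t p O.merged (gOf κ Φ t p O gv) (fOf κ Φ t p O fv)).bOf du.1) c' ∈ Finset.Icc (loN (fcellsA κ Φ t p O.merged (gOf κ Φ t p O gv) (fOf κ Φ t p O fv)) x du j pc (aw du) - ((E : ℕ) : Site 2)) (hiN (fcellsA κ Φ t p O.merged (gOf κ Φ t p O gv) (fOf κ Φ t p O fv)) x du j pc (aw du) + ((E : ℕ) : Site 2)) →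
      c' ∈ graphBall G t ((concRadii2N (fcellsA κ Φ t p O.merged (gOf κ Φ t p O gv) (fOf κ Φ t p O fv)) (Skelφ.Prm.gap (Sv κ Φ t p O.merged (gOf κ Φ t p O gv) (fOf κ Φ t p O fv) q)) (fun _ : ℕ => (0:ℕ)) (Skelφ.Prm.E₀ (Sv κ Φ t p O.merged (gOf κ Φ t p O gv) (fOf κ Φ t p O fv) q)) (Skelφ.Prm.Lp (Sv κ Φ t p O.merged (gOf κ Φ t p O gv) (fOf κ Φ t p O fv) q)) (offNA κ Φ t p O.merged (gOf κ Φ t p O gv) (fOf κ Φ t p O fv))).rE a' x du - r) →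
      (Skelφ.Prm.Lp (Sv κ Φ t p O.merged (gOf κ Φ t p O gv) (fOf κ Φ t p O fv) q)) ≤ (concRadii2N (fcellsA κ Φ t p O.merged (gOf κ Φ t p O gv) (fOf κ Φ t p O fv)) (Skelφ.Prm.gap (Sv κ Φ t p O.merged (gOf κ Φ t p O gv) (fOf κ Φ t p O fv) q)) (fun _ : ℕ => (0:ℕ)) (Skelφ.Prm.E₀ (Sv κ Φ t p O.merged (gOf κ Φ t p O gv) (fOf κ Φ t p O fv) q)) (Skelφ.Prm.Lp (Sv κ Φ t p O.merged (gOf κ Φ t p O gv) (fOf κ Φ t p O fv) q)) (offNA κ Φ t p O.merged (gOf κ Φ t p O gv) (fOf κ Φ t p O fv))).rM a' (x + stepVec du) → r ≤ (concRadii2N (fcellsA κ Φ t p O.merged (gOf κ Φ t p O gv) (fOf κ Φ t p O fv)) (Skelφ.Prm.gap (Sv κ Φ t p O.merged (gOf κ Φ t p O gv) (fOf κ Φ t p O fv) q)) (fun _ : ℕ => (0:ℕ)) (Skelφ.Prm.E₀ (Sv κ Φ t p O.merged (gOf κ Φ t p O gv) (fOf κ Φ t p O fv) q)) (Skelφ.Prm.Lp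 (Sv κ Φ t p O.merged (gOf κ Φ t p O gv) (fOf κ Φ t p O fv) q)) (offNA κ Φ t p O.merged (gOf κ Φ t p O gv) (fOf κ Φ t p O fv))).rE a' x du →
      FaceRunNumsX4 G (φL κ Φ t p O.D O.DT O.ori (gOf κ Φ t p O gv) (fOf κ Φ t p O fv)) ((prFA κ Φ t p O.merged (gOf κ Φ t p O gv) (fOf κ Φ t p O fv)).ψ (φL κ Φ t p O.D O.DT O.ori (gOf κ Φ t p O gv) (fOf κ Φ t p O fv)) t) c' (prFA κ Φ t p O.merged (gOf κ Φ t p O gv) (fOf κ Φ t p O fv)).A nL (prFA κ Φ t p O.merged (gOf κ Φ t p O gv) (fOf κ Φ t p O fv)).h (prFA κ Φ t p O.merged (gOf κ Φ t p O gv) (fOf κ Φ t p O fv)).vα (prFA κ Φ t p O.merged (gOf κ Φ t p O gv) (fOf κ Φ t p O fv)).vβ (prFA κ Φ t p O.merged (gOf κ Φ t p O gv) (fOf κ Φ t p O fv)).c₀ (prFA κ Φ t p O.merged (gOf κ Φ t p O gv) (fOf κ Φ t p O fv)).c₁ (prFA κ Φ t p O.merged (gOf κ Φ t p O gv) (fOf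 κ Φ t p O fv)).D du (sgOf du) (B (sgOf du)) ℓ' R's qB R'₃ qB₃ (prFA κ Φ t p O.merged (gOf κ Φ t p O gv) (fOf κ Φ t p O fv)).vα hnL hvL hlay Mz
        ((fcellsA κ Φ t p O.merged (gOf κ Φ t p O gv) (fOf κ Φ t p O fv)).farCore x du j k₀) (targetMM G (φL κ Φ t p O.D O.DT O.ori (gOf κ Φ t p O gv) (fOf κ Φ t p O fv)) (prFA κ Φ t p O.merged (gOf κ Φ t p O gv) (fOf κ Φ t p O fv)) (fcellsA κ Φ t p O.merged (gOf κ Φ t p O gv) (fOf κ Φ t p O fv)) t (concRadii2N (fcellsA κ Φ t p O.merged (gOf κ Φ t p O gv) (fOf κ Φ t p O fv)) (Skelφ.Prm.gap (Sv κ Φ t p O.merged (gOf κ Φ t p O gv) (fOf κ Φ t p O fv) q)) (fun _ : ℕ => (0:ℕ)) (Skelφ.Prm.E₀ (Sv κ Φ t p O.merged (gOf κ Φ t p O gv) (fOf κ Φ t p O fv) q)) (Skelφ.Prm.Lp (Sv κ Φ t p O.merged (gOf κ Φ t p O gv) (fOf κ Φ t p O fv) q)) (offNA κ Φ t p O.merged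 (gOf κ Φ t p O gv) (fOf κ Φ t p O fv))) (b0TA κ Φ t p O.merged (gOf κ Φ t p O gv) (fOf κ Φ t p O fv)) a' x du (Skelφ.Prm.Lp (Sv κ Φ t p O.merged (gOf κ Φ t p O gv) (fOf κ Φ t p O fv) q))) (Λc c' Mz) r (kA du.1) (kA (oth du.1)))
    (numsY : ∀ (a' : ℕ) (x : Site 2) (du : MDir) (j : ℕ) (pc : ℤ) (c' : V), du.1 = 1 → j < (fcellsA κ Φ t p O.merged (gOf κ Φ t p O gv) (fOf κ Φ t p O fv)).K → ∀ yF : V,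
      (prFA κ Φ t p O.merged (gOf κ Φ t p O gv) (fOf κ Φ t p O fv)).ψ (φL κ Φ t p O.D O.DT O.ori (gOf κ Φ t p O gv) (fOf κ Φ t p O fv)) t yF = (fcellsA κ Φ t p O.merged (gOf κ Φ t p O gv) (fOf κ Φ t p O fv)).faceCen x du j → pc = relφ (φL κ Φ t p O.D O.DT O.ori (gOf κ Φ t p O gv) (fOf κ Φ t p O fv)) t yF ((prFA κ Φ t p O.merged (gOf κ Φ t p O gv) (fOf κ Φ t p O fv)).bOf du.1) →
      (prFA κ Φ t p O.merged (gOf κ Φ t p O gv) (fOf κ Φ t p O fv)).frame (φL κ Φ t p O.D O.DT O.ori (gOf κ Φ t p O gv) (fOf κ Φ t p O fv)) t du.1 ((prFA κ Φ t p O.merged (gOf κ Φ t p O gv) (fOf κ Φ t p O fv)).bOf du.1) c' ∈ Finset.Icc (loN (fcellsA κ Φ t p O.merged (gOf κ Φ t p O gv) (fOf κ Φ t p O fv)) x du j pc (aw du) - ((E : ℕ) : Site 2)) (hiN (fcellsA κ Φ t p O.merged (gOf κ Φ t p O gv) (fOf κ Φ t p O fv)) x du j pc (aw du) + ((E : ℕ)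 : Site 2)) →
      c' ∈ graphBall G t ((concRadii2N (fcellsA κ Φ t p O.merged (gOf κ Φ t p O gv) (fOf κ Φ t p O fv)) (Skelφ.Prm.gap (Sv κ Φ t p O.merged (gOf κ Φ t p O gv) (fOf κ Φ t p O fv) q)) (fun _ : ℕ => (0:ℕ)) (Skelφ.Prm.E₀ (Sv κ Φ t p O.merged (gOf κ Φ t p O gv) (fOf κ Φ t p O fv) q)) (Skelφ.Prm.Lp (Sv κ Φ t p O.merged (gOf κ Φ t p O gv) (fOf κ Φ t p O fv) q)) (offNA κ Φ t p O.merged (gOf κ Φ t p O gv) (fOf κ Φ t p O fv))).rE a' x du - r) →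
      (Skelφ.Prm.Lp (Sv κ Φ t p O.merged (gOf κ Φ t p O gv) (fOf κ Φ t p O fv) q)) ≤ (concRadii2N (fcellsA κ Φ t p O.merged (gOf κ Φ t p O gv) (fOf κ Φ t p O fv)) (Skelφ.Prm.gap (Sv κ Φ t p O.merged (gOf κ Φ t p O gv) (fOf κ Φ t p O fv) q)) (fun _ : ℕ => (0:ℕ)) (Skelφ.Prm.E₀ (Sv κ Φ t p O.merged (gOf κ Φ t p O gv) (fOf κ Φ t p O fv) q)) (Skelφ.Prm.Lp (Sv κ Φ t p O.merged (gOf κ Φ t p O gv) (fOf κ Φ t p O fv) q)) (offNA κ Φ t p O.merged (gOf κ Φ t p O gv) (fOf κ Φ t p O fv))).rM a' (x + stepVec du) → r ≤ (concRadii2N (fcellsA κ Φ t p O.merged (gOf κ Φ t p O gv) (fOf κ Φ t p O fv)) (Skelφ.Prm.gap (Sv κ Φ t p O.merged (gOf κ Φ t p O gv) (fOf κ Φ t p O fv) q)) (fun _ : ℕ => (0:ℕ)) (Skelφ.Prm.E₀ (Sv κ Φ t p O.merged (gOf κ Φ t p O gv) (fOf κ Φ t p O fv) q)) (Skelφ.Prm.Lp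 (Sv κ Φ t p O.merged (gOf κ Φ t p O gv) (fOf κ Φ t p O fv) q)) (offNA κ Φ t p O.merged (gOf κ Φ t p O gv) (fOf κ Φ t p O fv))).rE a' x du →
      FaceRunNumsY4 G (φL κ Φ t p O.D O.DT O.ori (gOf κ Φ t p O gv) (fOf κ Φ t p O fv)) ((prFA κ Φ t p O.merged (gOf κ Φ t p O gv) (fOf κ Φ t p O fv)).ψ (φL κ Φ t p O.D O.DT O.ori (gOf κ Φ t p O gv) (fOf κ Φ t p O fv)) t) c' (prFA κ Φ t p O.merged (gOf κ Φ t p O gv) (fOf κ Φ t p O fv)).A nL (prFA κ Φ t p O.merged (gOf κ Φ t p O gv) (fOf κ Φ t p O fv)).h (prFA κ Φ t p O.merged (gOf κ Φ t p O gv) (fOf κ Φ t p O fv)).vα (prFA κ Φ t p O.merged (gOf κ Φ t p O gv) (fOf κ Φ t p O fv)).vβ (prFA κ Φ t p O.merged (gOf κ Φ t p O gv) (fOf κ Φ t p O fv)).c₀ (prFA κ Φ t p O.merged (gOf κ Φ t p O gv) (fOf κ Φ t p O fv)).c₁ (prFA κ Φ t p O.merged (gOf κ Φ t p O gv) (fOf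 κ Φ t p O fv)).D du (σhF du) (sgOf du) (B (σhF du)) ℓ' R's qB' R'₃ qB₃' (prFA κ Φ t p O.merged (gOf κ Φ t p O gv) (fOf κ Φ t p O fv)).vα hnL hvL
        hlay Mz ((fcellsA κ Φ t p O.merged (gOf κ Φ t p O gv) (fOf κ Φ t p O fv)).farCore x du j k₀) (targetMM G (φL κ Φ t p O.D O.DT O.ori (gOf κ Φ t p O gv) (fOf κ Φ t p O fv)) (prFA κ Φ t p O.merged (gOf κ Φ t p O gv) (fOf κ Φ t p O fv)) (fcellsA κ Φ t p O.merged (gOf κ Φ t p O gv) (fOf κ Φ t p O fv)) t (concRadii2N (fcellsA κ Φ t p O.merged (gOf κ Φ t p O gv) (fOf κ Φ t p O fv)) (Skelφ.Prm.gap (Sv κ Φ t p O.merged (gOf κ Φ t p O gv) (fOf κ Φ t p O fv) q)) (fun _ : ℕ => (0:ℕ)) (Skelφ.Prm.E₀ (Sv κ Φ t p O.merged (gOf κ Φ t p O gv) (fOf κ Φ t p O fv) q)) (Skelφ.Prm.Lp (Sv κ Φ t p O.merged (gOf κ Φ t p O gv) (fOf κ Φ t p O fv) q)) (offNA κ Φ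 t p O.merged (gOf κ Φ t p O gv) (fOf κ Φ t p O fv))) (b0TA κ Φ t p O.merged (gOf κ Φ t p O gv) (fOf κ Φ t p O fv)) a' x du (Skelφ.Prm.Lp (Sv κ Φ t p O.merged (gOf κ Φ t p O gv) (fOf κ Φ t p O fv) q))) (Λc c' Mz) r (kA du.1) (kA (oth du.1)))
    -- the providers' stride counts within the budget
    (hnFx : ∀ (a' : ℕ) (x : Site 2) (du : MDir) (j : ℕ) (pc : ℤ) (c' : V) (hI : du.1 = 0) (hj : j < (fcellsA κ Φ t p O.merged (gOf κ Φ t p O gv) (fOf κ Φ t p O fv)).K) (yF : V)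
      (hyF : (prFA κ Φ t p O.merged (gOf κ Φ t p O gv) (fOf κ Φ t p O fv)).ψ (φL κ Φ t p O.D O.DT O.ori (gOf κ Φ t p O gv) (fOf κ Φ t p O fv)) t yF = (fcellsA κ Φ t p O.merged (gOf κ Φ t p O gv) (fOf κ Φ t p O fv)).faceCen x du j) (hpc : pc = relφ (φL κ Φ t p O.D O.DT O.ori (gOf κ Φ t p O gv) (fOf κ Φ t p O fv)) t yF ((prFA κ Φ t p O.merged (gOf κ Φ t p O gv) (fOf κ Φ t p O fv)).bOf du.1))
      (h1 : (prFA κ Φ t p O.merged (gOf κ Φ t p O gv) (fOf κ Φ t p O fv)).frame (φL κ Φ t p O.D O.DT O.ori (gOf κ Φ t p O gv) (fOf κ Φ t p O fv)) t du.1 ((prFA κ Φ t p O.merged (gOf κ Φ t p O gv) (fOf κ Φ t p O fv)).bOf du.1) c' ∈ Finset.Icc (loN (fcellsA κ Φ t p O.merged (gOf κ Φ t p O gv) (fOf κ Φ t p O fv)) x du j pc (aw du) - ((E : ℕ) : Site 2)) (hiN (fcellsA κ Φ t p O.merged (gOf κ Φ t p O gv) (fOf κ Φ t p O fv)) x du j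 pc (aw du) + ((E : ℕ) : Site 2)))
      (h2 : c' ∈ graphBall G t ((concRadii2N (fcellsA κ Φ t p O.merged (gOf κ Φ t p O gv) (fOf κ Φ t p O fv)) (Skelφ.Prm.gap (Sv κ Φ t p O.merged (gOf κ Φ t p O gv) (fOf κ Φ t p O fv) q)) (fun _ : ℕ => (0:ℕ)) (Skelφ.Prm.E₀ (Sv κ Φ t p O.merged (gOf κ Φ t p O gv) (fOf κ Φ t p O fv) q)) (Skelφ.Prm.Lp (Sv κ Φ t p O.merged (gOf κ Φ t p O gv) (fOf κ Φ t p O fv) q)) (offNA κ Φ t p O.merged (gOf κ Φ t p O gv) (fOf κ Φ t p O fv))).rE a' x du - r))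
      (hM : (Skelφ.Prm.Lp (Sv κ Φ t p O.merged (gOf κ Φ t p O gv) (fOf κ Φ t p O fv) q)) ≤ (concRadii2N (fcellsA κ Φ t p O.merged (gOf κ Φ t p O gv) (fOf κ Φ t p O fv)) (Skelφ.Prm.gap (Sv κ Φ t p O.merged (gOf κ Φ t p O gv) (fOf κ Φ t p O fv) q)) (fun _ : ℕ => (0:ℕ)) (Skelφ.Prm.E₀ (Sv κ Φ t p O.merged (gOf κ Φ t p O gv) (fOf κ Φ t p O fv) q)) (Skelφ.Prm.Lp (Sv κ Φ t p O.merged (gOf κ Φ t p O gv) (fOf κ Φ t p O fv) q)) (offNA κ Φ t p O.merged (gOf κ Φ t p O gv) (fOf κ Φ t p O fv))).rM a' (x + stepVec du)) (hE : r ≤ (concRadii2N (fcellsA κ Φ t p O.merged (gOf κ Φ t p O gv) (fOf κ Φ t p O fv)) (Skelφ.Prm.gap (Sv κ Φ t p O.merged (gOf κ Φ t p O gv) (fOf κ Φ t p O fv) q)) (fun _ : ℕ => (0:ℕ)) (Skelφ.Prm.E₀ (Sv κ Φ t p O.merged (gOf κ Φ t p O gv) (fOf κ Φ t p O fv) q))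 (Skelφ.Prm.Lp (Sv κ Φ t p O.merged (gOf κ Φ t p O gv) (fOf κ Φ t p O fv) q)) (offNA κ Φ t p O.merged (gOf κ Φ t p O gv) (fOf κ Φ t p O fv))).rE a' x du),
      0 + 1 + (numsX a' x du j pc c' hI hj yF hyF hpc h1 h2 hM hE).Nr + 1 + (numsX a' x du j pc c' hI hj yF hyF hpc h1 h2 hM hE).N₃ ≤ nB)
    (hnFy : ∀ (a' : ℕ) (x : Site 2) (du : MDir) (j : ℕ) (pc : ℤ) (c' : V) (hI : du.1 = 1) (hj : j < (fcellsA κ Φ t p O.merged (gOf κ Φ t p O gv) (fOf κ Φ t p O fv)).K) (yF : V)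
      (hyF : (prFA κ Φ t p O.merged (gOf κ Φ t p O gv) (fOf κ Φ t p O fv)).ψ (φL κ Φ t p O.D O.DT O.ori (gOf κ Φ t p O gv) (fOf κ Φ t p O fv)) t yF = (fcellsA κ Φ t p O.merged (gOf κ Φ t p O gv) (fOf κ Φ t p O fv)).faceCen x du j) (hpc : pc = relφ (φL κ Φ t p O.D O.DT O.ori (gOf κ Φ t p O gv) (fOf κ Φ t p O fv)) t yF ((prFA κ Φ t p O.merged (gOf κ Φ t p O gv) (fOf κ Φ t p O fv)).bOf du.1))
      (h1 : (prFA κ Φ t p O.merged (gOf κ Φ t p O gv) (fOf κ Φ t p O fv)).frame (φL κ Φ t p O.D O.DT O.ori (gOf κ Φ t p O gv) (fOf κ Φ t p O fv)) t du.1 ((prFA κ Φ t p O.merged (gOf κ Φ t p O gv) (fOf κ Φ t p O fv)).bOf du.1) c' ∈ Finset.Icc (loN (fcellsA κ Φ t p O.merged (gOf κ Φ t p O gv) (fOf κ Φ t p O fv)) x du j pc (aw du) - ((E : ℕ) : Site 2)) (hiN (fcellsA κ Φ t p O.merged (gOf κ Φ t p O gv) (fOf κ Φ t p O fv)) x du j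 pc (aw du) + ((E : ℕ) : Site 2)))
      (h2 : c' ∈ graphBall G t ((concRadii2N (fcellsA κ Φ t p O.merged (gOf κ Φ t p O gv) (fOf κ Φ t p O fv)) (Skelφ.Prm.gap (Sv κ Φ t p O.merged (gOf κ Φ t p O gv) (fOf κ Φ t p O fv) q)) (fun _ : ℕ => (0:ℕ)) (Skelφ.Prm.E₀ (Sv κ Φ t p O.merged (gOf κ Φ t p O gv) (fOf κ Φ t p O fv) q)) (Skelφ.Prm.Lp (Sv κ Φ t p O.merged (gOf κ Φ t p O gv) (fOf κ Φ t p O fv) q)) (offNA κ Φ t p O.merged (gOf κ Φ t p O gv) (fOf κ Φ t p O fv))).rE a' x du - r))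
      (hM : (Skelφ.Prm.Lp (Sv κ Φ t p O.merged (gOf κ Φ t p O gv) (fOf κ Φ t p O fv) q)) ≤ (concRadii2N (fcellsA κ Φ t p O.merged (gOf κ Φ t p O gv) (fOf κ Φ t p O fv)) (Skelφ.Prm.gap (Sv κ Φ t p O.merged (gOf κ Φ t p O gv) (fOf κ Φ t p O fv) q)) (fun _ : ℕ => (0:ℕ)) (Skelφ.Prm.E₀ (Sv κ Φ t p O.merged (gOf κ Φ t p O gv) (fOf κ Φ t p O fv) q)) (Skelφ.Prm.Lp (Sv κ Φ t p O.merged (gOf κ Φ t p O gv) (fOf κ Φ t p O fv) q)) (offNA κ Φ t p O.merged (gOf κ Φ t p O gv) (fOf κ Φ t p O fv))).rM a' (x + stepVec du)) (hE : r ≤ (concRadii2N (fcellsA κ Φ t p O.merged (gOf κ Φ t p O gv) (fOf κ Φ t p O fv)) (Skelφ.Prm.gap (Sv κ Φ t p O.merged (gOf κ Φ t p O gv) (fOf κ Φ t p O fv) q)) (fun _ : ℕ => (0:ℕ)) (Skelφ.Prm.E₀ (Sv κ Φ t p O.merged (gOf κ Φ t p O gv) (fOf κ Φ t p O fv) q))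 (Skelφ.Prm.Lp (Sv κ Φ t p O.merged (gOf κ Φ t p O gv) (fOf κ Φ t p O fv) q)) (offNA κ Φ t p O.merged (gOf κ Φ t p O gv) (fOf κ Φ t p O fv))).rE a' x du),
      0 + 1 + (numsY a' x du j pc c' hI hj yF hyF hpc h1 h2 hM hE).Nr + 1 + (numsY a' x du j pc c' hI hj yF hyF hpc h1 h2 hM hE).N₃ ≤ nB) :
    Skelφ.FaceOblRM G ((choiceAtOTA κ Φ t p gv fv Sv hC Pv).scheme O q) ((choiceAtOTA κ Φ t p gv fv Sv hC Pv).FD O q) Φ.Δ κ.δ₂ :=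
  Skelφ.faceOblRM_of_kits9 (prFA κ Φ t p O.merged (gOf κ Φ t p O gv) (fOf κ Φ t p O fv)) (φL κ Φ t p O.D O.DT O.ori (gOf κ Φ t p O gv) (fOf κ Φ t p O fv)) (fcellsA κ Φ t p O.merged (gOf κ Φ t p O gv) (fOf κ Φ t p O fv)) t (Skelφ.Prm.gap (Sv κ Φ t p O.merged (gOf κ Φ t p O gv) (fOf κ Φ t p O fv) q)) (fun _ : ℕ => (0:ℕ)) (Skelφ.Prm.E₀ (Sv κ Φ t p O.merged (gOf κ Φ t p O gv) (fOf κ Φ t p O fv) q)) (Skelφ.Prm.Lp (Sv κ Φ t p O.merged (gOf κ Φ t p O gv) (fOf κ Φ t p O fv) q))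
    (offNA κ Φ t p O.merged (gOf κ Φ t p O gv) (fOf κ Φ t p O fv)) (b0TA κ Φ t p O.merged (gOf κ Φ t p O gv) (fOf κ Φ t p O fv)) q κ.δ
    (lip_φL κ Φ t p O.D O.DT O.ori (gOf κ Φ t p O gv) (fOf κ Φ t p O fv)) (steps_φL κ Φ t p O.D O.DT O.ori (gOf κ Φ t p O gv) (fOf κ Φ t p O fv)) hb₀ hb1 hc₀ hc₁ hDd hD hL0 hL1 hgap hgap20 hgapc hE₀ hL' hoff hoffN Rlev N M hRlev hRlev' aw hk₀ hk₀' hroomF hkF haw hcount hη R₁ hR₁ hdiam hgapR (Skelφ.frames_oriφ Φ.frame _) (Skelφ.cylConn_oriφ Φ.cyl_connected _) Φ.degree_le hA0 hnL hvL hmf hnC hU3 hδ₂ B hB σhF hσhF hκL ℓ' R's qB Rl R'₃ qB₃ qB' qB₃' hlay Rlev₁ N₁ j₀₁ j₁₁ Rlev₂ N₂ j₀₂ j₁₂ Rlev₃ N₃' j₀₃ j₁₃ hRl₁ hRl₂ hRl₃ hj₁ hj₂ hj₃ hB0 hRlr hΛR hΛQ0 hΛQ1 hΛZ hkA0 hkA1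 hkbMz hπ1 hclr₁ hδ hδ1 nB hchain hcount₁ hcount₂ hcount₃ hηk Pb Pr hPNb hAb hd1b hD1b hD2b hDρb hℓb hWb hKmaxb hKCmaxb hR'b hwideb hdwb hDwb hTb hT'b hr₀b hRb₀ hrsb hcSb hEb hreachb hr₁ hr₁R hPNr hAr hd1r hD1r hD2r hDρr hℓr hWr hKmaxr hKCmaxr hR'r hwider hdwr hDwr hwidey hdwy hDwy hwiderY hdwrY hDwrY hwideyY hdwyY hDwyY hTr hT'r hr₀r hRr₀ hrsr hcSr hEr hEy hreachr hr₂ hr₂R QK hRgRs hRgcard hcU1 hnSK hκSK hℓSK hκL10 Λc kz hkn hΛ hZ hMz hclrz hcz hzconn hRsr hZρ hρr hZU Qb Fb hQb hFb hFZ kk₁ kk₂ kk₃ hkN₁ hkN₂ hkN₃ hk₁ hk₂ hk₃ hzone hexitb hexitr hexity hbridge hlongx hlongy hR₁k hR₁b hR₁r PA hPN hA hd1 hD1 hD2 hDρ hℓ hW hKmax hKCmax hR' hMtan hMd hMD hT hT' hr₀ hr₀L hrs hcS hE hreach hn1 hEq hM4 hn2 hexitR hexitL hkC kk hN hk hzoneK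 hexitK numsX numsY hnFx hnFy

end NegB

end PlanarSkeletonNeg

end Summit.CriticalPhenomena.PercolationContinuityZ3.Theorems.Transplant

end
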